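import Summits.ResolutionOfSingularities.ResolutionOfSingularities.Theorems.EquisingularLiftEquisingularLiftNatMultisectionTrace
import Summits.ResolutionOfSingularities.ResolutionOfSingularities.Theorems.EquisingularLiftEquisingularLiftNatQuotientDVRAvoiding
import HarnessLib

/-!
# [OURS · L1 W4.5(b) · EL♮] T-MULTISEC, ASSEMBLED: a ramified multisection through every `k`-rational regular point of
# the special fibre, with prescribed trace on the running surface (crux `EquisingularLiftNat` = stmt-20038)

HONEST FRAMING. OURS (cell res-hironaka, crux chain w45b, slot W4.5(b)); NOT a statement of any manuscript; AI-written,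
weaker than expert review. Helper `--supports stmt-ResolutionOfSingularities-20038 --as helper`. This file is ONE `obtain`:
res-type-097's RING BRICK `exists_isPrime_isDiscreteValuationRing_quotient_not_mem` (p509659: a regular local ring has a
prime `𝔭` with DVR quotient avoiding a given non-zero `ϖ` and with `𝔭 + (u) = 𝔪` for a given `u ∈ 𝔪 ∖ 𝔪²`) fed into the
scheme-level package `exists_multisection_of_prime` (p509839 / p509091: Matsumura 8.4 finiteness over the complete base,
`closure {c} = {c, b}` by universal closedness, regularity / flatness / trace clause).

* `exists_multisection` — **T-MULTISEC** (res-L1-w45b-lead-2 TARGET 2026-08-27T06:51:13Z, in res-D-pv-013's (MS) shape):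
  `O` a COMPLETE DVR, `r : P → Spec O` PROPER, `T ⊆ r⁻¹{s₀}` closed (the running special-fibre surface), `z` a CLOSED point
  of `V(T)_red` such that, at `b := ι_T z`: `𝒪_{P,b}` is REGULAR, `O → 𝒪_{P,b}` is injective (horizontality of `P` at `b`;
  any integral `P` dominating `Spec O`), `O → κ(b)` is onto (`k`-rational), and `V(T)` drops the embedding dimension at `b`
  (`∃ u ∈ (I_T)_b ∖ 𝔪_b²` — «multisection-admissible», e.g. `emb dim_z V(T) ≤ dim 𝒪_{P,b} − 1`). THEN there is an ideal
  sheaf `C` on `P` with `V(C)` REGULAR, `V(C) ↪ P → Spec O` FLAT, `supp C ∩ r⁻¹{s₀} = {b}` and `C · 𝒪_{V(T)} = 𝓘_{{z}}`: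
  the blow-up of `P` along `C` is admissible (regular horizontal centre meeting the special fibre only at `b ∈ T`) and
  induces on the running surface `V(T)` exactly the blow-up of the reduced point `z` — «surface point blow-ups are
  admissible at EVERY point, good or bad» (MEMO-2 §7).

References: Matsumura Thm. 8.4, 14.2 [Matsumura1987]; Stacks 01W6 [StacksProject] — through the cited tree files.
OURS planning texts (index only): res-L1-w45b-lead-2 MEMO-2 v1.3 §7; res-D-pv-013 SIGNATURE T-Δ-ISO 07:06:22Z.
-/

set_option linter.dupNamespace false -- mandated namespace `Summit.<Summit>.<Problem>` of this single-conjunct summit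

open CategoryTheory AlgebraicGeometry TopologicalSpace Topology IsLocalRing
open AlgebraicGeometry.Scheme.IdealSheafData Literature.AlgebraicGeometry.Resolution

namespace Summit.ResolutionOfSingularities.ResolutionOfSingularities.Cruxes.EquisingularLiftNat.Sections

/-- **[OURS · L1 W4.5(b)] T-MULTISEC (ramified multisections exist, with prescribed trace).** `O` a complete discrete
valuation ring, `r : P → Spec O` proper, `T ⊆ r⁻¹{s₀}` closed, `z` a closed point of the reduced subscheme `V(T)` with
`b := ι_T z`; assume `𝒪_{P,b}` regular, the structure map `O → 𝒪_{P,b}` injective and onto `κ(b)` modulo `𝔪_b`, and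
`(I_T)_b ⊄ 𝔪_b²`. Then `∃ C : P.IdealSheafData` with `V(C)` regular, `V(C) → Spec O` flat (through `P`),
`supp C ∩ r⁻¹{s₀} = {b}` and `C · 𝒪_{V(T)} = 𝓘_{{z}}`. Proof: the uniformizer `ϖ` of `O` has non-zero image in
`𝒪_{P,b}`; the ring brick gives a prime `𝔭` with `𝒪_{P,b}/𝔭` a DVR, `ϖ ∉ 𝔭`, `𝔭 + (u) = 𝔪_b`; apply
`exists_multisection_of_prime`. NOT a statement of the manuscript. [cite: Matsumura1987, Thm. 8.4 and Thm. 14.2] -/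
theorem exists_multisection {O : Type} [CommRing O] [IsDomain O] [IsDiscreteValuationRing O]
    [IsAdicComplete (maximalIdeal O) O] {P : Scheme.{0}} (r : P ⟶ Spec (.of O)) [IsProper r]
    (T : Closeds P) (hT : (T : Set P) ⊆ r ⁻¹' {closedPoint O}) (z : ↥(vanishingIdeal T).subscheme)
    (hzc : IsClosed ({z} : Set ↥(vanishingIdeal T).subscheme))
    (hreg : IsRegularLocalRing (P.presheaf.stalk ((vanishingIdeal T).subschemeι z)))
    (hinj : Function.Injective ((Scheme.ΓSpecIso (.of O)).inv ≫
      (Spec (.of O)).presheaf.germ ⊤ (r ((vanishingIdeal T).subschemeι z)) trivial ≫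
        r.stalkMap ((vanishingIdeal T).subschemeι z)).hom)
    (hres : Function.Surjective ((residue (P.presheaf.stalk ((vanishingIdeal T).subschemeι z))).comp
      ((Scheme.ΓSpecIso (.of O)).inv ≫ (Spec (.of O)).presheaf.germ ⊤ (r ((vanishingIdeal T).subschemeι z)) trivial ≫
        r.stalkMap ((vanishingIdeal T).subschemeι z)).hom))
    (hadm : ∃ u ∈ stalkIdeal (vanishingIdeal T) ((vanishingIdeal T).subschemeι z),
      u ∉ maximalIdeal (P.presheaf.stalk ((vanishingIdeal T).subschemeι z)) ^ 2) :
    ∃ C : P.IdealSheafData, Scheme.IsRegular C.subscheme ∧ Flat (CategoryStruct.comp C.subschemeι r) ∧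
      (C.support : Set P) ∩ r ⁻¹' {closedPoint O} = {(vanishingIdeal T).subschemeι z} ∧
      C.comap (vanishingIdeal T).subschemeι = vanishingIdeal (⟨{z}, hzc⟩ : Closeds ↥(vanishingIdeal T).subscheme) := by
  set b := (vanishingIdeal T).subschemeι z with hbdef
  set φ := ((Scheme.ΓSpecIso (.of O)).inv ≫ (Spec (.of O)).presheaf.germ ⊤ (r b) trivial ≫ r.stalkMap b).hom with hφ
  haveI := hreg
  obtain ⟨ϖ, hϖ⟩ := IsDiscreteValuationRing.exists_irreducible O
  have hϖb : φ ϖ ≠ 0 := fun h => hϖ.ne_zero (hinj (by rw [h, map_zero]))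
  obtain ⟨u, huT, hu2⟩ := hadm
  have hbT : b ∈ (vanishingIdeal T).support := by
    rw [← SetLike.mem_coe, ← Scheme.IdealSheafData.range_subschemeι]; exact ⟨z, rfl⟩
  have hIle : stalkIdeal (vanishingIdeal T) b ≤ maximalIdeal _ := (mem_support_iff_stalkIdeal_le _ _).mp hbT
  have hu : u ∈ maximalIdeal (P.presheaf.stalk b) := hIle huT
  obtain ⟨p, hp, hdvr, hϖp, hpu⟩ :=
    exists_isPrime_isDiscreteValuationRing_quotient_not_mem (P.presheaf.stalk b) hu hu2 hϖb
  haveI := hp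
  haveI := hdvr
  have hne : ∃ a ∈ maximalIdeal O, Ideal.Quotient.mk p (φ a) ≠ 0 :=
    ⟨ϖ, (IsLocalRing.mem_maximalIdeal _).mpr hϖ.not_isUnit, fun h => hϖp ((Ideal.Quotient.eq_zero_iff_mem).mp h)⟩
  have htr : p ⊔ stalkIdeal (vanishingIdeal T) b = maximalIdeal (P.presheaf.stalk b) := by
    apply le_antisymm (sup_le (IsLocalRing.le_maximalIdeal hp.ne_top) hIle)
    rw [← hpu]
    exact sup_le_sup_left ((Ideal.span_singleton_le_iff_mem _).mpr huT) p
  exact exists_multisection_of_prime r T hT z hzc hres p hne htr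

end Summit.ResolutionOfSingularities.ResolutionOfSingularities.Cruxes.EquisingularLiftNat.Sections
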